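import Summits.QuantumFields.QCD.Theses.NestedDissectionSea
import Summits.QuantumFields.QCD.Theorems.EarlyCrosserLaw.Negative.LowerPinLoadBearing
import Summits.QuantumFields.QCD.Theorems.FrameAndSeparatorLaw.Negative.LowerPinLoadBearing
import Literature.MathematicalPhysics.QuantumFieldTheory.QCDGoldstoneBound

/-!
# Crux `LightQuarkCompletion` (stmt-QuantumFields-18066) — line `Sketch`, stub B2b: the physical branch from the frame (α)

Stub B2b of the registered skeleton (`stub_physicalBranch`, rev 1; `stub_frame` since rev 2) concludes `m_crit(k) → 0` for a
THRESHOLD regularisation `reg` (both scalings, weak branch, the two-sided parity pin `PinClause ∧ UpperPin` above `M₀ ≥ 0`, the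
`QCDOf` body above `M₀`) whose re-centring at some germ carries the zero-threshold pin.  Conjunct (α) of the route's own crux
`FrameAndSeparatorLaw` (stmt-QuantumFields-17012), abbreviated in the tree as `FrameAndSeparatorLawNegative.Frame`, says exactly
that a two-sided pin above a threshold (`TwoSidedPin`, which is `PinClause ∧ UpperPin` by the landed `twoSidedPin_iff`) forces
`m_crit → 0` along EVERY admissible regularisation of `N_f ∈ {2,3}`.  Hence B2b follows from (α) BY NAME, using only the scalings
and the threshold pin among its hypotheses (`physicalBranch_of_frame`), and a fortiori from the crux `FrameAndSeparatorLaw`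
(`physicalBranch_of_frameAndSeparatorLaw`, the registered helper signature verbatim).  This is the kernel-checked reason the line
delegates B2b to item 17012: no worker re-attacks a disguised copy of (α).

Pure logic over landed definitions; no definition introduced; nothing here asserts a Theses decl unconditionally (lead c1's
helper C1, re-derived by lead c2, 2026-08-17).
-/

noncomputable section

namespace Summit.QuantumFields.QCD.Theorems.LightQuarkJumpLine

open MeasureTheory Filter Topology
open Literature.MathematicalPhysics.QuantumFieldTheory Literature.MathematicalPhysics.QuantumLattice
  Literature.Probability.LatticeModels
open Summit.QuantumFields.QCD.Theorems.CoerciveSeaNegative (PinClause)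
open Summit.QuantumFields.QCD.Theorems.EarlyCrosserLawNegative (UpperPin)
open Summit.QuantumFields.QCD.Theorems.FrameAndSeparatorLawNegative (Frame TwoSidedPin twoSidedPin_iff)

/-- **B2b from the frame (α), core form.**  If (α) `FrameAndSeparatorLawNegative.Frame` holds, then every regularisation of
`N_f ∈ {2,3}` with both scalings whose determinant sign is pinned from both sides above some `M₀ ≥ 0` (`PinClause ∧ UpperPin`
at every tuple `> M₀`) has `m_crit(k) → 0` — the threshold pin is (α)'s hypothesis by `twoSidedPin_iff`. [folklore] -/
theorem physicalBranch_of_frame (hF : Frame) :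
    ∀ Nf : ℕ, (Nf = 2 ∨ Nf = 3) → ∀ reg : QCDRegularisation Nf, reg.HasMassScaling →
    (reg.scheme 0 0 0).HasAsymptoticScaling → ∀ M₀ : ℝ, 0 ≤ M₀ →
    (∀ m : Fin Nf → ℝ, (∀ f, M₀ < m f) → ∃ R : ℝ, 0 < R ∧ PinClause Nf reg M₀ m R ∧ UpperPin Nf reg M₀ m R) →
    Tendsto reg.mcrit atTop (𝓝 0) := by
  intro Nf hNf reg hMS hAS M₀ hM₀ hpin
  exact hF Nf reg hNf hMS hAS M₀ hM₀ fun m hm => by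
    obtain ⟨R, hR, hb, hu⟩ := hpin m hm
    exact ⟨R, hR, (twoSidedPin_iff Nf reg M₀ m R).2 ⟨hb, hu⟩⟩

/-- **B2b from the crux `FrameAndSeparatorLaw` (registered helper signature, verbatim).**  The rev-1 stub
`stub_physicalBranch` of line `Sketch` — `m_crit → 0` for a threshold regularisation (both scalings, weak branch, two-sided pin
and body above `M₀ ≥ 0`) whose re-centring at some germ `J` carries the zero-threshold pin — follows from the route crux
`NestedDissectionSea.FrameAndSeparatorLaw` (item 17012): its conjunct (α) is `Frame` (`frameAndSeparatorLaw_iff`, `Iff.rfl`),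
and `physicalBranch_of_frame` uses only the scalings and the threshold pin (the weak branch, the body, the germ and the
zero-threshold pin are idle). [folklore] -/
theorem physicalBranch_of_frameAndSeparatorLaw :
    Summit.QuantumFields.QCD.Theses.NestedDissectionSea.FrameAndSeparatorLaw →
    ∀ Nf : ℕ, (Nf = 2 ∨ Nf = 3) → ∀ reg : QCDRegularisation Nf, reg.HasMassScaling →
    (reg.scheme 0 0 0).HasAsymptoticScaling → (∀ᶠ k : ℕ in atTop, -1 ≤ reg.mcrit k) → ∀ M₀ : ℝ, 0 ≤ M₀ →
    (∀ m : Fin Nf → ℝ, (∀ f, M₀ < m f) → ∃ R : ℝ, 0 < R ∧ PinClause Nf reg M₀ m R ∧ UpperPin Nf reg M₀ m R) →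
    (∀ m : Fin Nf → ℝ, (∀ f, M₀ < m f) → ∃ (z shift : QCDField Nf → ℕ → ℝ) (T : OSData (QCDField Nf) 4),
      IsQCDAlong (reg.scheme m z shift) T ∧ T.IsNontrivial QCDField.glue ∧ T.IsNonGaussian QCDField.glue ∧
        (∀ f g : Fin Nf, f ≠ g → T.IsNontrivial (QCDField.pseudoRe f g)) ∧
          ∃ Δ > 0, T.HasMassGap Δ ∧ (reg.scheme m z shift).HasLatticeMassGap Δ) →
    ∀ J : ℝ, (∀ m : Fin Nf → ℝ, (∀ f, 0 < m f) → ∃ R : ℝ, 0 < R ∧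
      PinClause Nf (QCDRegularisation.mk reg.a reg.a_pos reg.tendsto_a reg.β reg.L reg.tendsto_L
        (fun k => reg.mcrit k + reg.a k * J / reg.Zm k) reg.Zm reg.Zm_pos) 0 m R ∧
      UpperPin Nf (QCDRegularisation.mk reg.a reg.a_pos reg.tendsto_a reg.β reg.L reg.tendsto_L
        (fun k => reg.mcrit k + reg.a k * J / reg.Zm k) reg.Zm reg.Zm_pos) 0 m R) →
    Tendsto reg.mcrit atTop (𝓝 0) := by
  intro hFS Nf hNf reg hMS hAS _hbr M₀ hM₀ hpin _hbody _J _hpin'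
  exact physicalBranch_of_frame hFS.1 Nf hNf reg hMS hAS M₀ hM₀ hpin

end Summit.QuantumFields.QCD.Theorems.LightQuarkJumpLine

end
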